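import Summits.Ventures.PercRepro.OneEdgeMono

/-!
# PercRepro — `G − e` inside the cube of `G`: the bridge from `deleteEdge` to typer-2's `cubeSumDel` (p1, gen 5)

`CS(G − e)` (the class sum of the multigraph `G.deleteEdge e`, `OneEdgeMono.lean`) is also the class sum of `G`
with `e` closed in both copies — typer-2's `cubeSumDel` (`CubeSum.lean`) — which is the form in which the slack
of `G` splits by the state of `e` (mine-3 §16 add. 5).  Parked beside `OneEdgeMono.lean` for the prover of
`OneEdgeMonoC026` (lead 2159: not ordered; proposed only if that proof asks for it).

* **`extFalse`** — a configuration of `G − e` extended to `G` by closing `e`; `extFalse_restrict`, `extFalse_compl`;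
* **`conn_deleteEdge_iff`**, **`markedPartition_deleteEdge`** — connectivity and the marked partition transport;
* **`cubeSumQuad_deleteEdge`** — `(G.deleteEdge e).cubeSumQuad m A = cubeSumDel A (fun ρ => G.markedPartition ρ m) e`
  for any kernel `A` and any marks (`Finset.sum_nbij'` over the `e`-closed half of the cube of `G`);
* **`oneEdgeMonoC026_iff_cubeSumDel`** — the hypothesis `OneEdgeMonoC026` restated with `cubeSumDel`;
* **`cubeSumCon`** — the class sum with `e` contracted (open in both copies), `CS(G/e)`;
  `cubeSumCon_eq_faceSum` / `cubeSumCon_eq_minorQuad`: it is the class sum of the minor `G/e`;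
* **`Crosswise`** — the crosswise set `C₂(G, e)` of mine-3 §16 add. 2 (c) / §17.2: configurations of `G − e` in
  which `e` is pivotal for `a ~ b`, while in the antipode (inside `G − e`) `e` is pivotal for `c ~ {a, b}`;
* **`cubeSumQuad_kernel26_eq_del_add_con`** — the class deletion–contraction identity (mine-3's M3-DC, the
  class analogue of M3-REC): `CS(G) = CS(G − e) + CS(G/e) − #C₂(G, e)`, for `kernel26`;
* **`deleteEdge_le_iff_crosswise_le_con`** — hence `OneEdgeMonoC026` at `e` ⟺ `#C₂(G, e) ≤ CS(G/e)`
  (class-`(Con)`), the bridge statement of record between the def and the dossier (lead 2185 (d));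
* the `a–b` edge tie (`CS(G − e) = CS(G)`) is in `OneEdgeMonoAB.lean`.
-/

namespace PercRepro

open Finset

section Bridge

variable {E : Type*} [DecidableEq E]

/-- A configuration of `G − e`, extended to `G` by closing `e`. -/
def extFalse (e : E) (ρ : Config {f : E // f ≠ e}) : Config E :=
  fun f => if h : f = e then false else ρ ⟨f, h⟩

/-- The extension closes `e`. -/
@[simp] theorem extFalse_self (e : E) (ρ : Config {f : E // f ≠ e}) : extFalse e ρ e = false := by
  simp [extFalse]

/-- The extension agrees with `ρ` away from `e`. -/
theorem extFalse_of_ne (e : E) (ρ : Config {f : E // f ≠ e}) {f : E} (hf : f ≠ e) :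
    extFalse e ρ f = ρ ⟨f, hf⟩ := by
  simp [extFalse, hf]

/-- Restricting a configuration with `e` closed and extending it back is the identity. -/
theorem extFalse_restrict (e : E) {ρ : Config E} (hρ : ρ e = false) :
    extFalse e (fun f => ρ f.1) = ρ := by
  funext f
  by_cases hf : f = e
  · subst hf
    rw [extFalse_self, hρ]
  · rw [extFalse_of_ne e _ hf]

/-- The extension of the antipode is the antipode with `e` re-closed. -/
theorem extFalse_compl (e : E) (ρ : Config {f : E // f ≠ e}) :
    extFalse e ρᶜ = Function.update (extFalse e ρ)ᶜ e false := by
  funext f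
  by_cases hf : f = e
  · subst hf
    rw [extFalse_self, Function.update_self]
  · rw [Function.update_of_ne hf, compl_apply_bool, extFalse_of_ne e _ hf, extFalse_of_ne e _ hf,
      compl_apply_bool]

namespace MultiGraph

variable {V : Type*} (G : MultiGraph V E)

/-- **Connectivity transports** between `G − e` and the extension by the closed edge `e`. -/
theorem conn_deleteEdge_iff (e : E) (ρ : Config {f : E // f ≠ e}) (u v : V) :
    (G.deleteEdge e).Conn ρ u v ↔ G.Conn (extFalse e ρ) u v := by
  unfold Conn
  constructor
  · intro h
    induction h with
    | refl => exact Relation.ReflTransGen.refl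
    | tail _ hxy ih =>
      obtain ⟨f, hf, hxy⟩ := hxy
      refine ih.tail ⟨f.1, ?_, hxy⟩
      rw [extFalse_of_ne e ρ f.2]
      exact hf
  · intro h
    induction h with
    | refl => exact Relation.ReflTransGen.refl
    | tail _ hxy ih =>
      obtain ⟨f, hf, hxy⟩ := hxy
      have hfe : f ≠ e := by
        rintro rfl
        rw [extFalse_self] at hf
        exact Bool.false_ne_true hf
      refine ih.tail ⟨⟨f, hfe⟩, ?_, hxy⟩
      rw [extFalse_of_ne e ρ hfe] at hf
      exact hf

/-- **The marked partition transports** between `G − e` and the extension. -/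
theorem markedPartition_deleteEdge (e : E) (ρ : Config {f : E // f ≠ e}) {k : ℕ} (m : Fin k → V) :
    (G.deleteEdge e).markedPartition ρ m = G.markedPartition (extFalse e ρ) m :=
  Setoid.ext fun i j => G.conn_deleteEdge_iff e ρ (m i) (m j)

variable [Fintype E]

/-- **The class sum of `G − e` is the deletion sum of `G`** (typer-2's `cubeSumDel`: `e` closed in both
copies), for any kernel and any marks. -/
theorem cubeSumQuad_deleteEdge (e : E) {k : ℕ} (m : Fin k → V)
    (A : Setoid (Fin k) → Setoid (Fin k) → ℝ) :
    (G.deleteEdge e).cubeSumQuad m A = cubeSumDel A (fun ρ => G.markedPartition ρ m) e := by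
  unfold cubeSumQuad cubeSum cubeSumDel
  rw [← Finset.sum_filter]
  symm
  refine Finset.sum_nbij' (fun ρ => fun f => ρ f.1) (extFalse e) (fun _ _ => Finset.mem_univ _)
    (fun ρ _ => Finset.mem_filter.2 ⟨Finset.mem_univ _, extFalse_self e ρ⟩) ?_ ?_ ?_
  · intro ρ hρ
    exact extFalse_restrict e (Finset.mem_filter.1 hρ).2
  · intro ρ _
    funext f
    exact extFalse_of_ne e ρ f.2
  · intro ρ hρ
    have h0 : extFalse e (fun f => ρ f.1) = ρ := extFalse_restrict e (Finset.mem_filter.1 hρ).2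
    simp only [G.markedPartition_deleteEdge, extFalse_compl, h0]

end MultiGraph

end Bridge

/-- **`OneEdgeMonoC026` in the vocabulary of typer-2's deletion sum**: `CS(G − e)` is
`cubeSumDel kernel26 (fun ρ => G.markedPartition ρ ![a, b, c]) e`, the class sum of `G` with `e` closed in
both copies. -/
theorem oneEdgeMonoC026_iff_cubeSumDel : OneEdgeMonoC026 ↔
    ∀ {V E : Type} [Fintype V] [Fintype E] [DecidableEq E] (G : MultiGraph V E), G.IsSimple →
      ∀ a b c : V, a ≠ b → a ≠ c → b ≠ c → ∀ e : E, ¬ G.IsABNonMarkEdge a b c e →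
        cubeSumDel kernel26 (fun ρ => G.markedPartition ρ ![a, b, c]) e ≤
          G.cubeSumQuad ![a, b, c] kernel26 := by
  constructor
  · intro h V E _ _ _ G hs a b c hab hac hbc e he
    rw [← G.cubeSumQuad_deleteEdge]
    exact h G hs a b c hab hac hbc e he
  · intro h V E _ _ _ G hs a b c hab hac hbc e he
    rw [G.cubeSumQuad_deleteEdge]
    exact h G hs a b c hab hac hbc e he

/-! ### The class deletion–contraction identity `CS(G) = CS(G − e) + CS(G/e) − #C₂` -/

section DelCon

variable {E : Type*} [Fintype E] [DecidableEq E] {ι : Type*}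

/-- The class sum with `e` CONTRACTED (open in both copies): `CS(G/e)`. -/
noncomputable def cubeSumCon (K : ι → ι → ℝ) (c : Config E → ι) (e : E) : ℝ :=
  ∑ ρ : Config E, if ρ e = true then K (c ρ) (c (Function.update ρᶜ e true)) else 0

/-- `cubeSumCon K c e` is the class sum of the class «`e` sure, everything else free» (the contraction
`G/e`; the twin of typer-2's `cubeSumDel_eq_faceSum`). -/
theorem cubeSumCon_eq_faceSum (K : ι → ι → ℝ) (c : Config E → ι) (e : E) :
    cubeSumCon K c e = faceSum K c (fun _ => true) (fun x => decide (x = e)) := by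
  unfold cubeSumCon faceSum
  rw [← Finset.sum_filter]
  symm
  refine Finset.sum_nbij' (fun ρ => embed (fun _ => true) (fun x => decide (x = e)) ρ)
    (fun ω => restrict (fun _ => true) (fun x => decide (x = e)) ω) ?_ ?_ ?_ ?_ ?_
  · intro ρ _
    simp only [Finset.mem_filter, Finset.mem_univ, true_and]
    rw [embed_apply_of_not _ _ _ (by simp)]
    simp
  · intro ω _
    exact Finset.mem_univ _
  · intro ρ _
    exact restrict_embed _ _ ρ
  · intro ω hω
    simp only [Finset.mem_filter, Finset.mem_univ, true_and] at hω
    funext x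
    by_cases hx : x = e
    · subst hx
      rw [embed_apply_of_not _ _ _ (by simp), hω]
      simp
    · rw [embed_apply_of_mem _ _ _ ⟨by simp [hx], rfl⟩]
      rfl
  · intro ρ _
    congr 2
    funext x
    by_cases hx : x = e
    · subst hx
      rw [embed_apply_of_not _ _ _ (by simp), Function.update_self]
      simp
    · rw [embed_apply_of_mem _ _ _ ⟨by simp [hx], rfl⟩, Function.update_of_ne hx,
        compl_apply_bool, compl_apply_bool, embed_apply_of_mem _ _ _ ⟨by simp [hx], rfl⟩]

/-- Flipping `e` is a bijection between the `e`-open and the `e`-closed configurations: a sum over the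
`e`-open half is a sum over the `e`-closed half of the flipped summand. -/
theorem sum_filter_true_eq_sum_filter_false (e : E) (f : Config E → ℝ) :
    ∑ ρ ∈ Finset.univ.filter (fun ρ : Config E => ρ e = true), f ρ =
      ∑ ρ ∈ Finset.univ.filter (fun ρ : Config E => ρ e = false), f (Function.update ρ e true) := by
  refine Finset.sum_nbij' (fun ρ => Function.update ρ e false) (fun ρ => Function.update ρ e true)
    (fun ρ _ => Finset.mem_filter.2 ⟨Finset.mem_univ _, Function.update_self ..⟩)
    (fun ρ _ => Finset.mem_filter.2 ⟨Finset.mem_univ _, Function.update_self ..⟩) ?_ ?_ ?_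
  · intro ρ hρ
    rw [Function.update_idem, update_eq_self_of_eq (Finset.mem_filter.1 hρ).2]
  · intro ρ hρ
    rw [Function.update_idem, update_eq_self_of_eq (Finset.mem_filter.1 hρ).2]
  · intro ρ hρ
    rw [Function.update_idem, update_eq_self_of_eq (Finset.mem_filter.1 hρ).2]

namespace MultiGraph

variable {V : Type*} (G : MultiGraph V E)

omit [Fintype E] [DecidableEq E] in
open Classical in
/-- **The kernel on an arbitrary pair** (p5's `kernel26_eq_ite` for `(ρ, τ)` in place of `(ρ, ρᶜ)`):
`kernel26(Π(ρ), Π(τ)) = [ρ one pair] − [a ~_ρ b ∧ c iso in τ]`. -/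
theorem kernel26_eq_ite' (a b c : V) (ρ τ : Config E) :
    kernel26 (G.markedPartition ρ ![a, b, c]) (G.markedPartition τ ![a, b, c]) =
      (if G.OnePair ρ a b c then 1 else 0) -
        (if G.Conn ρ a b ∧ G.IsCIso τ a b c then 1 else 0) := by
  unfold kernel26
  simp only [G.rowInd3_eq_ite]
  have e0 := G.partitionEvent_row_abc a b c
  have e1 := G.partitionEvent_row_ab_c a b c
  have e2 := G.partitionEvent_row_ac_b a b c
  have e3 := G.partitionEvent_row_bc_a a b c
  have e4 := G.partitionEvent_row_a_b_c a b c
  simp only [show rgs3 0 = ![0, 0, 0] from rfl, show rgs3 1 = ![0, 0, 1] from rfl,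
    show rgs3 2 = ![0, 1, 0] from rfl, show rgs3 3 = ![0, 1, 1] from rfl,
    show rgs3 4 = ![0, 1, 2] from rfl, e0, e1, e2, e3, e4, Set.mem_inter_iff, mem_connEvent,
    mem_sepEvent, OnePair, IsCIso]
  rcases G.rows3_cases a b c ρ with ⟨hab, hac, hbc⟩ | ⟨hab, hac, hbc⟩ | ⟨hab, hac, hbc⟩ |
      ⟨hab, hac, hbc⟩ | ⟨hab, hac, hbc⟩ <;>
    rcases G.rows3_cases a b c τ with ⟨hab', hac', hbc'⟩ | ⟨hab', hac', hbc'⟩ |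
      ⟨hab', hac', hbc'⟩ | ⟨hab', hac', hbc'⟩ | ⟨hab', hac', hbc'⟩ <;>
    simp [hab, hac, hbc, hab', hac', hbc']

/-- **`CS(G/e)` is the class sum of the minor «`e` contracted»**, any kernel, any marks (the twin of
typer-2's `cubeSumDel_eq_minorQuad`). -/
theorem cubeSumCon_eq_minorQuad {k : ℕ} (m : Fin k → V) (A : Setoid (Fin k) → Setoid (Fin k) → ℝ)
    (e : E) :
    cubeSumCon A (fun ρ => G.markedPartition ρ m) e =
      (G.minor (fun _ => true) (fun x => decide (x = e))).cubeSumQuad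
        (fun i => G.sureClass (fun x => decide (x = e)) (m i)) A := by
  rw [cubeSumCon_eq_faceSum, ← G.faceSumQuad_eq_minor]
  rfl

/-- **The crosswise set `C₂(G, e)`** (mine-3 §16 add. 2 (c)): configurations `ρ` of `G − e` (read in `G`
with `e` closed) in which `e` is pivotal for `a ~ b`, while in the antipode inside `G − e` (`ρᶜ` with `e`
re-closed) the edge `e` is pivotal for `c ~ {a, b}`. -/
def Crosswise (a b c : V) (e : E) (ρ : Config E) : Prop :=
  ρ e = false ∧ ¬ G.Conn ρ a b ∧ G.Conn (Function.update ρ e true) a b ∧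
    G.IsCIso (Function.update ρᶜ e false) a b c ∧ ¬ G.IsCIso ρᶜ a b c

omit [Fintype E] in
/-- Closing an edge keeps `c` isolated. -/
theorem isCIso_update_false {ω : Config E} {a b c : V} (h : G.IsCIso ω a b c) (e : E) :
    G.IsCIso (Function.update ω e false) a b c :=
  ⟨fun h' => h.1 (G.conn_update_false h'), fun h' => h.2 (G.conn_update_false h')⟩

omit [Fintype E] in
open Classical in
/-- **The pointwise four-term identity** on the `e`-closed half: with `ρ' = ρ[e := 1]` and
`ρ̄₀ = ρᶜ[e := 0]`, `k(ρ, ρᶜ) + k(ρ', ρ̄₀) − k(ρ, ρ̄₀) − k(ρ', ρᶜ) = −[ρ ∈ C₂]` — the `[one pair]` terms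
cancel and the product terms leave `−([a ~ b]_{ρ'} − [a ~ b]_ρ)·([c iso]_{ρ̄₀} − [c iso]_{ρᶜ})`. -/
theorem kernel26_four_term (a b c : V) (e : E) {ρ : Config E} (hρ : ρ e = false) :
    kernel26 (G.markedPartition ρ ![a, b, c]) (G.markedPartition ρᶜ ![a, b, c]) +
        kernel26 (G.markedPartition (Function.update ρ e true) ![a, b, c])
          (G.markedPartition (Function.update ρᶜ e false) ![a, b, c]) -
      kernel26 (G.markedPartition ρ ![a, b, c])
        (G.markedPartition (Function.update ρᶜ e false) ![a, b, c]) -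
      kernel26 (G.markedPartition (Function.update ρ e true) ![a, b, c])
        (G.markedPartition ρᶜ ![a, b, c]) =
      -(if G.Crosswise a b c e ρ then 1 else 0) := by
  simp only [G.kernel26_eq_ite']
  by_cases h1 : G.Conn ρ a b
  · have h2 : G.Conn (Function.update ρ e true) a b := h1.update_true
    by_cases h3 : G.IsCIso ρᶜ a b c
    · have h4 := G.isCIso_update_false h3 e
      simp [Crosswise, hρ, h1, h2, h3, h4]
    · by_cases h4 : G.IsCIso (Function.update ρᶜ e false) a b c <;>
        simp [Crosswise, hρ, h1, h2, h3, h4]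
  · by_cases h2 : G.Conn (Function.update ρ e true) a b
    · by_cases h3 : G.IsCIso ρᶜ a b c
      · have h4 := G.isCIso_update_false h3 e
        simp [Crosswise, hρ, h1, h2, h3, h4]
      · by_cases h4 : G.IsCIso (Function.update ρᶜ e false) a b c <;>
          simp [Crosswise, hρ, h1, h2, h3, h4]
    · by_cases h3 : G.IsCIso ρᶜ a b c
      · have h4 := G.isCIso_update_false h3 e
        simp [Crosswise, hρ, h1, h2, h3, h4]
      · by_cases h4 : G.IsCIso (Function.update ρᶜ e false) a b c <;>
          simp [Crosswise, hρ, h1, h2, h3, h4]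

open Classical in
/-- **The class deletion–contraction identity** (mine-3's M3-DC, the class analogue of M3-REC):
`CS(G) = CS(G − e) + CS(G/e) − #C₂(G, e)` for the kernel of C-026. -/
theorem cubeSumQuad_kernel26_eq_del_add_con (a b c : V) (e : E) :
    G.cubeSumQuad ![a, b, c] kernel26 =
      cubeSumDel kernel26 (fun ρ => G.markedPartition ρ ![a, b, c]) e +
        cubeSumCon kernel26 (fun ρ => G.markedPartition ρ ![a, b, c]) e -
          ((Finset.univ.filter fun ρ : Config E => G.Crosswise a b c e ρ).card : ℝ) := by
  -- the four sums as sums over the `e`-closed half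
  have hF : G.cubeSumQuad ![a, b, c] kernel26 =
      ∑ ρ ∈ Finset.univ.filter (fun ρ : Config E => ρ e = false),
        (kernel26 (G.markedPartition ρ ![a, b, c]) (G.markedPartition ρᶜ ![a, b, c]) +
          kernel26 (G.markedPartition (Function.update ρ e true) ![a, b, c])
            (G.markedPartition (Function.update ρᶜ e false) ![a, b, c])) := by
    unfold cubeSumQuad cubeSum
    rw [← Finset.sum_filter_add_sum_filter_not Finset.univ (fun ρ : Config E => ρ e = false),
      Finset.sum_add_distrib]
    refine congrArg₂ (· + ·) rfl ?_
    simp only [Bool.not_eq_false]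
    rw [sum_filter_true_eq_sum_filter_false]
    refine Finset.sum_congr rfl fun ρ _ => ?_
    simp only [compl_update, Bool.not_true]
  have hD : cubeSumDel kernel26 (fun ρ => G.markedPartition ρ ![a, b, c]) e =
      ∑ ρ ∈ Finset.univ.filter (fun ρ : Config E => ρ e = false),
        kernel26 (G.markedPartition ρ ![a, b, c])
          (G.markedPartition (Function.update ρᶜ e false) ![a, b, c]) := by
    unfold cubeSumDel
    rw [Finset.sum_filter]
  have hC : cubeSumCon kernel26 (fun ρ => G.markedPartition ρ ![a, b, c]) e =
      ∑ ρ ∈ Finset.univ.filter (fun ρ : Config E => ρ e = false),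
        kernel26 (G.markedPartition (Function.update ρ e true) ![a, b, c])
          (G.markedPartition ρᶜ ![a, b, c]) := by
    unfold cubeSumCon
    rw [← Finset.sum_filter, sum_filter_true_eq_sum_filter_false]
    refine Finset.sum_congr rfl fun ρ hρ => ?_
    simp only [compl_update, Bool.not_true, Function.update_idem,
      update_eq_self_of_eq (compl_apply_of_eq_false (Finset.mem_filter.1 hρ).2)]
  have hX : ((Finset.univ.filter fun ρ : Config E => G.Crosswise a b c e ρ).card : ℝ) =
      ∑ ρ ∈ Finset.univ.filter (fun ρ : Config E => ρ e = false),
        (if G.Crosswise a b c e ρ then (1 : ℝ) else 0) := by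
    rw [Finset.card_filter, Nat.cast_sum, Finset.sum_filter]
    refine Finset.sum_congr rfl fun ρ _ => ?_
    by_cases h : G.Crosswise a b c e ρ
    · simp [h, h.1]
    · simp [h]
  rw [hF, hD, hC, hX, ← Finset.sum_add_distrib, ← Finset.sum_sub_distrib]
  refine Finset.sum_congr rfl fun ρ hρ => ?_
  have := G.kernel26_four_term a b c e (Finset.mem_filter.1 hρ).2
  linarith

open Classical in
/-- `cubeSumDel` of `kernel26` as a count: `#{ρ ∌ e : one pair} − #{ρ ∌ e : a ~ b ∧ c iso in ρᶜ[e := 0]}`. -/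
theorem cubeSumDel_kernel26_eq (a b c : V) (e : E) :
    cubeSumDel kernel26 (fun ρ => G.markedPartition ρ ![a, b, c]) e =
      ((Finset.univ.filter fun ρ : Config E => ρ e = false ∧ G.OnePair ρ a b c).card : ℝ) -
        ((Finset.univ.filter fun ρ : Config E => ρ e = false ∧ G.Conn ρ a b ∧
          G.IsCIso (Function.update ρᶜ e false) a b c).card : ℝ) := by
  unfold cubeSumDel
  simp only [G.kernel26_eq_ite']
  rw [Finset.card_filter, Finset.card_filter, Nat.cast_sum, Nat.cast_sum, ← Finset.sum_sub_distrib]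
  refine Finset.sum_congr rfl fun ρ _ => ?_
  by_cases h : ρ e = false <;> simp [h]

open Classical in
/-- **`OneEdgeMonoC026` at `e` is class-`(Con)`**: `CS(G − e) ≤ CS(G)` iff `#C₂(G, e) ≤ CS(G/e)`
(the bridge statement of record between the def and mine-3's dossier, lead 2185 (d)). -/
theorem deleteEdge_le_iff_crosswise_le_con (a b c : V) (e : E) :
    (G.deleteEdge e).cubeSumQuad ![a, b, c] kernel26 ≤ G.cubeSumQuad ![a, b, c] kernel26 ↔
      ((Finset.univ.filter fun ρ : Config E => G.Crosswise a b c e ρ).card : ℝ) ≤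
        cubeSumCon kernel26 (fun ρ => G.markedPartition ρ ![a, b, c]) e := by
  rw [G.cubeSumQuad_deleteEdge, G.cubeSumQuad_kernel26_eq_del_add_con a b c e]
  constructor <;> intro h <;> linarith

end MultiGraph

end DelCon

end PercRepro
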